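import Summits.CriticalPhenomena.Ising3D.TaylorRegionDeltaLitTails
import Mathlib.Tactic.Linarith
import Mathlib.Tactic.Positivity
import Mathlib.Tactic.Ring
import HarnessLib

/-!
# The literal-table even region with cheap pieces AND mixed-mode tail cells (`…_of_splitΔLPM`)
(cell `pub-ising3x`, seat recog-1 gen 13; gate (g2) — kernel measurements HOME/pub-ising3x-recog-1/gen13/KERNEL-DELTA.md)

HONEST FRAMING: lottery ticket; floor = tightest certified 3D Ising CFT bounds; no exact-solution
claim without a proof. Island framing: certified exclusion region at stated derivative order and
assumptions; not a determination of the 3D Ising critical exponents beyond that.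

`taylorEvenRegion_of_splitΔLP` (TaylorRegionDeltaLitEvenP) with the three tail families decided cell by cell in a
producer-chosen MODE (`MX MY MD : List Bool`; `true` = interval-Horner column enclosures, `false` = the landed Taylor
shift; TaylorRegionDeltaLitTails): **`EvenRegionDataΔ.tailXCellOKM / tailYCellOKM / tailDCellOKM`**,
**`taylorEvenRegion_of_splitΔLPM`**, `TaylorTable.evenRegion_of_splitΔLPM`. The proof is the `…ΔLP` one with
`halfStripPos2M_sound` / `halfStripPosDM_sound` in the tail branch. Elementary. [folklore]
-/

namespace Summit.CriticalPhenomena.Ising3D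

open Finset Set
open Literature.Analysis.ValidatedNumerics Literature.Analysis.ValidatedNumerics.PolyMP
open Literature.Analysis.ValidatedNumerics.NumericsMP (MI)
open Literature.MathematicalPhysics.QuantumFieldTheory.ConformalBootstrap3D

namespace EvenRegionDataΔ

variable (d : EvenRegionDataΔ)

/-- The `k`-th θ-cell of the `X` tail on the literal table, mode `modes[k]`. [folklore] -/
def tailXCellOKM (LT : IPoly2 × IPoly2 × IPoly2 × IPoly2) (modes : List Bool) (k : ℕ) : Bool :=
  hsCellM d.S LT.1 (d.E1 - d.ccT) d.prmX modes k

/-- The `k`-th θ-cell of the `Y` tail on the literal table, mode `modes[k]`. [folklore] -/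
def tailYCellOKM (LT : IPoly2 × IPoly2 × IPoly2 × IPoly2) (modes : List Bool) (k : ℕ) : Bool :=
  hsCellM d.S LT.2.1 (d.E1 - d.ccT) d.prmY modes k

/-- The `k`-th θ-cell of the discriminant tail on the literal tables `(LTX, LTY, LTZ₃ + LTZ₄)`, mode `modes[k]`. [folklore] -/
def tailDCellOKM (LT : IPoly2 × IPoly2 × IPoly2 × IPoly2) (modes : List Bool) (k : ℕ) : Bool :=
  hsCellDM d.S LT.1 LT.2.1 (add2I LT.2.2.1 LT.2.2.2) (d.E1 - d.ccT) d.prmD modes k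

end EvenRegionDataΔ

/-- **The even region over a wide box from literal tables, cheap pieces, mixed-mode tail cells.** [folklore] -/
theorem taylorEvenRegion_of_splitΔLPM (d : EvenRegionDataΔ) (LP LT : IPoly2 × IPoly2 × IPoly2 × IPoly2)
    (TT : ITab3 × ITab3 × ITab3 × ITab3) (L : List (ITriple × ITriple × ITriple)) (B : List (List ℚ))
    (MX MY MD : List Bool) (hl : d.l.Nodup) (hs : d.sizesOK = true)
    (hnX : 0 < d.prmX.nθ) (hnY : 0 < d.prmY.nθ) (hlen : d.tailLenOK LT = true)
    (hPD : ∀ c : ℕ, c < 4 → d.pdLitOK LP c = true)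
    (hmom : ∀ c r : ℕ, c < 4 → r < d.R → d.momRowLitOK LP LT c r = true)
    (hX : ∀ k : ℕ, k < d.prmX.nθ → d.tailXCellOKM LT MX k = true)
    (hY : ∀ k : ℕ, k < d.prmY.nθ → d.tailYCellOKM LT MY k = true)
    (hD : ∀ k : ℕ, k < d.prmD.nθ → d.tailDCellOKM LT MD k = true)
    (hT : ∀ c m : ℕ, c < 4 → m < 3 → d.tabOKc TT c m = true)
    (hr : ∀ j : ℕ, j < d.J1 + 1 → d.rowLitOKL TT L j = true)
    (hpc : ∀ j k : ℕ, j < d.J1 + 1 → k < numPieces B j → d.pieceOKBP L B j k = true) :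
    TaylorEvenRegion (taylorCrossing (1 / 2) (1 / 2) d.l.toFinset fun i ab => (d.cQ i ab : ℝ))
      (Icc (d.σlo : ℝ) d.σhi ×ˢ Icc (d.εlo : ℝ) d.εhi) ((d.E0 : ℚ) : ℝ) := by
  simp only [EvenRegionDataΔ.sizesOK, EvenRegionDataH.sizesOK, Bool.and_eq_true, decide_eq_true_eq] at hs
  obtain ⟨⟨⟨⟨⟨⟨⟨⟨⟨⟨⟨⟨⟨⟨⟨⟨⟨hS, hE0⟩, hJ1⟩, hR⟩, hN0⟩, hN1⟩, hN3⟩, hN4⟩, hθX⟩, hθY⟩, hθD⟩, hnD⟩, hσ⟩, hε⟩,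
    hZX⟩, hZY⟩, hZ3⟩, hZ4⟩ := hs
  simp only [EvenRegionDataΔ.tailLenOK, Bool.and_eq_true, decide_eq_true_eq] at hlen
  obtain ⟨⟨⟨lX, lY⟩, lZ3⟩, lZ4⟩ := hlen
  -- normalise the `toH` projections to the fields of `d` (all definitional)
  have hS : 0 < d.S := hS
  have hE0 : 0 < d.E0 := hE0
  have hJ1 : d.E1 ≤ (d.J1 : ℚ) + 1 := hJ1
  have hR : momLenOK d.N d.R = true := hR
  have hN0 : kernelSizeOK d.S (d.cQ 0) (-1) (enclQ d.S d.σlo d.σhi) d.ccT d.l d.N = true := hN0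
  have hN1 : kernelSizeOK d.S (d.cQ 1) (-1) (enclQ d.S d.εlo d.εhi) d.ccT d.l d.N = true := hN1
  have hN3 : kernelSizeOK d.S (d.cQ 3) (-1) (enclQ d.S ((d.σlo + d.εlo) / 2) ((d.σhi + d.εhi) / 2)) d.ccT d.l d.N =
      true := hN3
  have hN4 : kernelSizeOK d.S (d.cQ 4) 1 (enclQ d.S ((d.σlo + d.εlo) / 2) ((d.σhi + d.εhi) / 2)) d.ccT d.l d.N =
      true := hN4
  have hθX : 1 ≤ d.prmX.θhi := hθX
  have hθY : 1 ≤ d.prmY.θhi := hθY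
  have hθD : 1 ≤ d.prmD.θhi := hθD
  have hnD : 0 < d.prmD.nθ := hnD
  -- the split containments, component by component (definitional unfolding of `proj4` / `comp*`)
  have pdX : subset2I (kernelPDLI d.S (d.cQ 0) (-1) (signedChooseI d.S (enclQ d.S d.σlo d.σhi)) d.ccT d.l) LP.1 =
      true := hPD 0 (by norm_num)
  have pdY : subset2I (kernelPDLI d.S (d.cQ 1) (-1) (signedChooseI d.S (enclQ d.S d.εlo d.εhi)) d.ccT d.l) LP.2.1 =
      true := hPD 1 (by norm_num)
  have pd3 : subset2I (kernelPDLI d.S (d.cQ 3) (-1)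
      (signedChooseI d.S (enclQ d.S ((d.σlo + d.εlo) / 2) ((d.σhi + d.εhi) / 2))) d.ccT d.l) LP.2.2.1 = true :=
    hPD 2 (by norm_num)
  have pd4 : subset2I (kernelPDLI d.S (d.cQ 4) 1
      (signedChooseI d.S (enclQ d.S ((d.σlo + d.εlo) / 2) ((d.σhi + d.εhi) / 2))) d.ccT d.l) LP.2.2.2 = true :=
    hPD 3 (by norm_num)
  have mrX : ∀ r : ℕ, r < d.R → subsetI (substMomRowI d.S LP.1 d.ccT d.N r) (LT.1.getD r []) = true :=
    fun r hr => hmom 0 r (by norm_num) hr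
  have mrY : ∀ r : ℕ, r < d.R → subsetI (substMomRowI d.S LP.2.1 d.ccT d.N r) (LT.2.1.getD r []) = true :=
    fun r hr => hmom 1 r (by norm_num) hr
  have mr3 : ∀ r : ℕ, r < d.R → subsetI (substMomRowI d.S LP.2.2.1 d.ccT d.N r) (LT.2.2.1.getD r []) = true :=
    fun r hr => hmom 2 r (by norm_num) hr
  have mr4 : ∀ r : ℕ, r < d.R → subsetI (substMomRowI d.S LP.2.2.2 d.ccT d.N r) (LT.2.2.2.getD r []) = true :=
    fun r hr => hmom 3 r (by norm_num) hr
  have tX : ∀ m : ℕ, m < 3 → tabOK d.S (d.cQ 0) (-1) d.σ0 d.Wσ d.ccQ d.l TT.1 m = true :=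
    fun m hm => hT 0 m (by norm_num) hm
  have tY : ∀ m : ℕ, m < 3 → tabOK d.S (d.cQ 1) (-1) d.ε0 d.Wε d.ccQ d.l TT.2.1 m = true :=
    fun m hm => hT 1 m (by norm_num) hm
  have t3 : ∀ m : ℕ, m < 3 → tabOK d.S (d.cQ 3) (-1) d.b0 d.Wb d.ccQ d.l TT.2.2.1 m = true :=
    fun m hm => hT 2 m (by norm_num) hm
  have t4 : ∀ m : ℕ, m < 3 → tabOK d.S (d.cQ 4) 1 d.b0 d.Wb d.ccQ d.l TT.2.2.2 m = true :=
    fun m hm => hT 3 m (by norm_num) hm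
  have hWσ : 0 ≤ d.Wσ := by unfold EvenRegionDataΔ.Wσ; linarith
  have hWε : 0 ≤ d.Wε := by unfold EvenRegionDataΔ.Wε; linarith
  have hWb : 0 ≤ d.Wb := by unfold EvenRegionDataΔ.Wb; linarith
  refine taylorEvenRegion_half_of_qRegion _ _ _ _ fun p hp E j hE hj => ?_
  obtain ⟨h1, h2, h3, h4⟩ : (d.σlo : ℝ) ≤ p.1 ∧ p.1 ≤ d.σhi ∧ (d.εlo : ℝ) ≤ p.2 ∧ p.2 ≤ d.εhi := by
    simp only [Set.mem_prod, Set.mem_Icc] at hp; exact ⟨hp.1.1, hp.1.2, hp.2.1, hp.2.2⟩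
  have hsσ : MI.mem d.S p.1 (enclQ d.S d.σlo d.σhi) := mem_enclQ _ h1 h2
  have hsε : MI.mem d.S p.2 (enclQ d.S d.εlo d.εhi) := mem_enclQ _ h3 h4
  have hsb : MI.mem d.S ((p.1 + p.2) / 2) (enclQ d.S ((d.σlo + d.εlo) / 2) ((d.σhi + d.εhi) / 2)) :=
    mem_enclQ _ (by push_cast; linarith) (by push_cast; linarith)
  have hEpos : 0 < E := lt_of_lt_of_le (by exact_mod_cast hE0) hE
  by_cases hE1 : ((d.E1 : ℚ) : ℝ) ≤ E
  · -- TAIL: the landed (E, θ) machinery on the LITERAL tables (containment through the literal (P, D) tables)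
    have hθ := div_mem_unit hEpos hj
    have hP : ((d.E1 - d.ccT : ℚ) : ℝ) ≤ E - d.ccT := by push_cast; linarith
    have eX := qSum_eq_eval2_momTable hS (d.cQ 0) (-1) hsσ d.ccT hl hN0 hR hEpos j
    have eY := qSum_eq_eval2_momTable hS (d.cQ 1) (-1) hsε d.ccT hl hN1 hR hEpos j
    have eZ3 := qSum_eq_eval2_momTable hS (d.cQ 3) (-1) hsb d.ccT hl hN3 hR hEpos j
    have eZ4 := qSum_eq_eval2_momTable hS (d.cQ 4) 1 hsb d.ccT hl hN4 hR hEpos j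
    have pX : PMem2 d.S (momTable (d.cQ 0) (-1) p.1 d.ccT d.l d.N d.R) LT.1 :=
      pmem2_substMom_of_rows hS (pmem2_of_subset2I (pmem2_kernelPDLI_of_mem hS hsσ (d.cQ 0) (-1) d.ccT d.l) pdX)
        d.ccT d.N d.R lX mrX
    have pY : PMem2 d.S (momTable (d.cQ 1) (-1) p.2 d.ccT d.l d.N d.R) LT.2.1 :=
      pmem2_substMom_of_rows hS (pmem2_of_subset2I (pmem2_kernelPDLI_of_mem hS hsε (d.cQ 1) (-1) d.ccT d.l) pdY)
        d.ccT d.N d.R lY mrY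
    have pZ3 : PMem2 d.S (momTable (d.cQ 3) (-1) ((p.1 + p.2) / 2) d.ccT d.l d.N d.R) LT.2.2.1 :=
      pmem2_substMom_of_rows hS (pmem2_of_subset2I (pmem2_kernelPDLI_of_mem hS hsb (d.cQ 3) (-1) d.ccT d.l) pd3)
        d.ccT d.N d.R lZ3 mr3
    have pZ4 : PMem2 d.S (momTable (d.cQ 4) 1 ((p.1 + p.2) / 2) d.ccT d.l d.N d.R) LT.2.2.2 :=
      pmem2_substMom_of_rows hS (pmem2_of_subset2I (pmem2_kernelPDLI_of_mem hS hsb (d.cQ 4) 1 d.ccT d.l) pd4)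
        d.ccT d.N d.R lZ4 mr4
    have pZ := pmem2_add2I pZ3 pZ4
    have hX' : ∀ k : ℕ, k < d.prmX.nθ → hsCellM d.S LT.1 (d.E1 - d.ccT) d.prmX MX k = true := hX
    have hY' : ∀ k : ℕ, k < d.prmY.nθ → hsCellM d.S LT.2.1 (d.E1 - d.ccT) d.prmY MY k = true := hY
    have hD' : ∀ k : ℕ, k < d.prmD.nθ →
        hsCellDM d.S LT.1 LT.2.1 (add2I LT.2.2.1 LT.2.2.2) (d.E1 - d.ccT) d.prmD MD k = true := hD
    have vX := halfStripPos2M_sound hS pX (lt_of_lt_of_le zero_lt_one hθX) hnX hX' hP hθ.1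
      (hθ.2.trans (by exact_mod_cast hθX))
    have vY := halfStripPos2M_sound hS pY (lt_of_lt_of_le zero_lt_one hθY) hnY hY' hP hθ.1
      (hθ.2.trans (by exact_mod_cast hθY))
    have vD := halfStripPosDM_sound hS pX pY pZ (lt_of_lt_of_le zero_lt_one hθD) hnD hD' hP hθ.1
      (hθ.2.trans (by exact_mod_cast hθD))
    rw [eval2_add2] at vD
    simp only [Rat.cast_neg, Rat.cast_one] at eX eY eZ3 eZ4
    have goalD : (qSum (fun ab => (d.cQ 3 ab : ℝ)) d.l.toFinset ((p.1 + p.2) / 2) (-1) E j +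
        qSum (fun ab => (d.cQ 4 ab : ℝ)) d.l.toFinset ((p.1 + p.2) / 2) 1 E j) ^ 2 ≤
        4 * qSum (fun ab => (d.cQ 0 ab : ℝ)) d.l.toFinset p.1 (-1) E j *
          qSum (fun ab => (d.cQ 1 ab : ℝ)) d.l.toFinset p.2 (-1) E j := by
      rw [eX, eY, eZ3, eZ4, sq]; linarith
    exact ⟨by rw [eX]; exact vX.le, by rw [eY]; exact vY.le, goalD⟩
  · -- BOUNDED PART: δ-expanded row triples from the literal tables
    have hElt : E < d.E1 := lt_of_not_ge hE1
    have hjJ : j < d.J1 + 1 := by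
      have h1' : (j : ℝ) < (d.J1 : ℝ) + 1 := by
        have : ((d.E1 : ℚ) : ℝ) ≤ (d.J1 : ℝ) + 1 := by exact_mod_cast hJ1
        linarith
      exact_mod_cast h1'
    -- the three δ's
    have hδσ : |p.1 - d.σ0| ≤ d.Wσ := by
      unfold EvenRegionDataΔ.σ0 EvenRegionDataΔ.Wσ; push_cast; rw [abs_le]; constructor <;> linarith
    have hδε : |p.2 - d.ε0| ≤ d.Wε := by
      unfold EvenRegionDataΔ.ε0 EvenRegionDataΔ.Wε; push_cast; rw [abs_le]; constructor <;> linarith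
    have hδb : |(p.1 + p.2) / 2 - d.b0| ≤ d.Wb := by
      unfold EvenRegionDataΔ.b0 EvenRegionDataΔ.Wb EvenRegionDataΔ.σ0 EvenRegionDataΔ.Wσ EvenRegionDataΔ.ε0
        EvenRegionDataΔ.Wε
      push_cast; rw [abs_le]; constructor <;> linarith
    -- the four q-sums as triples
    have eX := qSum_eq_delta_rows hS (d.cQ 0) (-1) d.σ0 hWσ d.ccQ hl hZX hδσ E j
    have eY := qSum_eq_delta_rows hS (d.cQ 1) (-1) d.ε0 hWε d.ccQ hl hZY hδε E j
    have eZ3 := qSum_eq_delta_rows hS (d.cQ 3) (-1) d.b0 hWb d.ccQ hl hZ3 hδb E j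
    have eZ4 := qSum_eq_delta_rows hS (d.cQ 4) 1 d.b0 hWb d.ccQ hl hZ4 hδb E j
    have aσ : ((d.σ0 : ℚ) : ℝ) + (p.1 - d.σ0) = p.1 := by ring
    have aε : ((d.ε0 : ℚ) : ℝ) + (p.2 - d.ε0) = p.2 := by ring
    have ab : ((d.b0 : ℚ) : ℝ) + ((p.1 + p.2) / 2 - d.b0) = (p.1 + p.2) / 2 := by ring
    rw [aσ] at eX; rw [aε] at eY; rw [ab] at eZ3 eZ4
    simp only [Rat.cast_neg, Rat.cast_one] at eX eY eZ3 eZ4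
    -- memberships of the real triples in the triples from the literal tables, then in the literal rows
    have qX := pmem3_tripL hS (d.cQ 0) (-1) d.σ0 hWσ d.ccQ d.l tX d.N j hδσ
    have qY := pmem3_tripL hS (d.cQ 1) (-1) d.ε0 hWε d.ccQ d.l tY d.N j hδε
    have q3 := pmem3_tripL hS (d.cQ 3) (-1) d.b0 hWb d.ccQ d.l t3 d.N j hδb
    have q4 := pmem3_tripL hS (d.cQ 4) 1 d.b0 hWb d.ccQ d.l t4 d.N j hδb
    have qZ := pmem3_add q3 q4
    have hrow := hr j hjJ
    simp only [EvenRegionDataΔ.rowLitOKL, EvenRegionDataΔ.rowLitRowOK, Bool.and_eq_true] at hrow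
    obtain ⟨⟨sX, sY⟩, sZ⟩ := hrow
    have mX := pmem3_of_subset3 qX sX
    have mY := pmem3_of_subset3 qY sY
    have mZ := pmem3_of_subset3 qZ sZ
    -- locate the piece of P = E − cc among the producer breakpoints
    have hmE2 : max (d.E0 : ℝ) (j : ℝ) ≤ E := max_le hE hj
    set K : ℕ := numPieces B j with hKdef
    have hK : 0 < K := numPieces_pos B j
    have e0 : d.bp B j 0 = max d.E0 (j : ℚ) - d.ccQ := d.bp_zero B j
    have eK : d.bp B j K = d.E1 - d.ccQ := d.bp_numPieces B j
    have hn1 : K - 1 + 1 = K := Nat.sub_add_cancel hK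
    obtain ⟨k, hk, hk1, hk2⟩ := exists_mem_gridCell (fun k : ℕ => ((d.bp B j k : ℚ) : ℝ)) (K - 1)
      (Δ := E - d.ccQ) (by show ((d.bp B j 0 : ℚ) : ℝ) ≤ E - d.ccQ; rw [e0]; push_cast; linarith [hmE2])
      (by show E - d.ccQ ≤ ((d.bp B j (K - 1 + 1) : ℚ) : ℝ); rw [hn1, eK]; push_cast; linarith)
    have hkK : k < K := by omega
    have hpiece := hpc j k hjJ hkK
    have hpiece' : d.pieceRowOKP (L.getD j EvenRegionDataΔ.noLit3) (B.getD j []) j k = true := hpiece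
    simp only [EvenRegionDataΔ.pieceRowOKP, Bool.or_eq_true, decide_eq_true_eq] at hpiece'
    rcases hpiece' with hvac | rD
    · exfalso
      have hmE : ((max d.E0 (j : ℚ) : ℚ) : ℝ) ≤ E := by push_cast; exact hmE2
      have : ((d.E1 : ℚ) : ℝ) < ((max d.E0 (j : ℚ) : ℚ) : ℝ) := by exact_mod_cast hvac
      linarith
    have hk1' : ((d.bpRow (B.getD j []) j k : ℚ) : ℝ) ≤ E - d.ccQ := hk1
    have hk2' : E - d.ccQ ≤ ((d.bpRow (B.getD j []) j (k + 1) : ℚ) : ℝ) := hk2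
    obtain ⟨vX, vY, vD⟩ := posOnDE3P_sound hS hWσ hWε hWb mX mY mZ le_rfl le_rfl rD hk1' hk2' hδσ hδε hδb
    rw [val3_add] at vD
    simp only [val3] at vX vY vD
    refine ⟨?_, ?_, ?_⟩
    · rw [eX]; exact vX.le
    · rw [eY]; exact vY.le
    · rw [eX, eY, eZ3, eZ4, sq]; linarith [vD]


namespace TaylorTable

variable (T : TaylorTable)

/-- **The table's even region from the literal-table Booleans, cheap pieces, mixed-mode tails.** [folklore] -/
theorem evenRegion_of_splitΔLPM (π : EvenRegionParamsΔ) (LP LT : IPoly2 × IPoly2 × IPoly2 × IPoly2)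
    (TT : ITab3 × ITab3 × ITab3 × ITab3) (L : List (ITriple × ITriple × ITriple)) (B : List (List ℚ))
    (MX MY MD : List Bool) (hl : (T.evenDataΔ π).l.Nodup) (hs : (T.evenDataΔ π).sizesOK = true)
    (hnX : 0 < (T.evenDataΔ π).prmX.nθ) (hnY : 0 < (T.evenDataΔ π).prmY.nθ)
    (hlen : (T.evenDataΔ π).tailLenOK LT = true)
    (hPD : ∀ c : ℕ, c < 4 → (T.evenDataΔ π).pdLitOK LP c = true)
    (hmom : ∀ c r : ℕ, c < 4 → r < (T.evenDataΔ π).R → (T.evenDataΔ π).momRowLitOK LP LT c r = true)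
    (hX : ∀ k : ℕ, k < (T.evenDataΔ π).prmX.nθ → (T.evenDataΔ π).tailXCellOKM LT MX k = true)
    (hY : ∀ k : ℕ, k < (T.evenDataΔ π).prmY.nθ → (T.evenDataΔ π).tailYCellOKM LT MY k = true)
    (hD : ∀ k : ℕ, k < (T.evenDataΔ π).prmD.nθ → (T.evenDataΔ π).tailDCellOKM LT MD k = true)
    (hT : ∀ c m : ℕ, c < 4 → m < 3 → (T.evenDataΔ π).tabOKc TT c m = true)
    (hr : ∀ j : ℕ, j < (T.evenDataΔ π).J1 + 1 → (T.evenDataΔ π).rowLitOKL TT L j = true)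
    (hp : ∀ j k : ℕ, j < (T.evenDataΔ π).J1 + 1 → k < numPieces B j → (T.evenDataΔ π).pieceOKBP L B j k = true) :
    TaylorEvenRegion T.α T.box ((T.E₀ : ℚ) : ℝ) :=
  taylorEvenRegion_of_splitΔLPM (T.evenDataΔ π) LP LT TT L B MX MY MD hl hs hnX hnY hlen hPD hmom hX hY hD hT hr hp

end TaylorTable

end Summit.CriticalPhenomena.Ising3D
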